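import Literature.NumberTheory.EllipticCurves.RationalIsogenyFrobeniusCriterionPrimePower
import Literature.NumberTheory.EllipticCurves.RationalIsogenyFrobeniusCertificatesGenusOne
import Literature.NumberTheory.EllipticCurves.RationalIsogenyFrobeniusCertificatesCaseC
import HarnessLib

/-!
# Kenku's levels `63 = 7·9` and `75 = 3·25`: no cyclic `ℚ`-isogeny of degree `9` out of the
# `X₀(21)`-tabulated `j`, nor of degree `25` out of the `X₀(15)`-tabulated `j` (prime-power certificates)

Topic `NumberTheory/EllipticCurves`; theorems only (no definition, no named fact). The eight rows `(j, 9)` for the four non-cuspidal values of `X₀(21)` and `(j, 25)` for the four of `X₀(15)` (the level `81 = 3⁴`, row `(-12288000, 81)`, is `Summits/…/IsogenyGlueCongruenceMazurKenkuBoundStubEightyone.lean`).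
Mechanism (Mazur 1978, Prop. 6.3 (1), prime-power form; Kenku 1982, proof of Thm. 1): a cyclic
`ℚ`-isogeny of degree `pᵏ` out of `W` transports along `j(W) = j(E₀)` to a `Γ_ℚ`-stable cyclic
subgroup of order `pᵏ` on the tabulated globally minimal model `E₀`, whose character
`r : Γ_ℚ → (ℤ/pᵏ)ˣ` has `r(φ_ℓ)² − a_ℓ r(φ_ℓ) + ℓ ≡ 0 (mod pᵏ)` at a good prime `ℓ ≠ p` — the
landed criterion `j_ne_of_isogeny_cyclic_primePow_degree_of_certificate`
(`RationalIsogenyFrobeniusCriterionPrimePower.lean`) fed with the kernel-decided rows `card_…` /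
`noroot_…` of `RationalIsogenyFrobeniusCertificates*.lean`. These theorems are what replaces
Kenku's uniqueness schema ("two rational cyclic `N`-subgroups never coexist") in the radius form
of the Mazur–Kenku theorem (crux `MazurKenkuBound` of `Summits/ABC`, line `radius-lite`).

## References

* [Mazur1978] B. Mazur, *Rational isogenies of prime degree*, Invent. Math. 44 (1978) 129–162:
  §6 Prop. 6.3 (1) (p. 153), table p. 129.
* [Kenku1982] M. A. Kenku, *On the number of ℚ-isomorphism classes of elliptic curves in each
  ℚ-isogeny class*, J. Number Theory 15 (1982) 199–202, proof of Thm. 1, pp. 200–201.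
-/

noncomputable section

open scoped Classical
open WeierstrassCurve
open Literature.NumberTheory.EllipticCurves

namespace Literature.NumberTheory.EllipticCurves.KenkuLevelsCert

/-- The prime-power criterion `j_ne_of_isogeny_cyclic_primePow_degree_of_certificate` with the
arithmetic `a_ℓ = ℓ + 1 − n` and `m = pᵏ` pre-evaluated, so that each row is fed by its
kernel-decided witness verbatim. [cite: Mazur1978, §6 Prop. 6.3 (1) (p. 153)] -/
private theorem j_ne_of_primePow_row (E₀ : WeierstrassCurve ℤ) {B : ℕ}
    (hB : E₀.Δ.natAbs < B ^ 12)
    (hdec : ∀ p ∈ Finset.range B, p.Prime →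
      ¬ (p ^ 12 ∣ E₀.Δ.natAbs) ∨ ¬ (p ∣ E₀.c₄.natAbs))
    (hc₄ : E₀.c₄ ≠ 0) (hc₆ : E₀.c₆ ≠ 0)
    {ℓ : ℕ} [Fact ℓ.Prime] (hℓΔ : ¬ (ℓ ∣ E₀.Δ.natAbs)) {n : ℕ}
    (hcard : Nat.card ((E₀.map (Int.castRingHom (ZMod ℓ))).toAffine.Point) = n)
    {p k : ℕ} [Fact p.Prime] (hℓp : ℓ ≠ p) {a : ℤ} (ha : (ℓ : ℤ) + 1 - n = a) {m : ℕ}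
    (hm : p ^ k = m) (hnoroot : ∀ t : ZMod m, t ^ 2 - (a : ZMod m) * t + (ℓ : ZMod m) ≠ 0)
    {W W' : WeierstrassCurve ℚ} [W.IsElliptic] [W'.IsElliptic] (ψ : Isogeny W W')
    (hψ : ψ.IsCyclic) (hq : ψ.degree = m) : W.j ≠ (E₀.c₄ : ℚ) ^ 3 / (E₀.Δ : ℚ) := by
  subst hm ha
  exact j_ne_of_isogeny_cyclic_primePow_degree_of_certificate E₀ hB hdec hc₄ hc₆ hℓΔ hcard hℓp
    hnoroot ψ hψ hq

/-- No cyclic `ℚ`-isogeny of degree `9 = 3²` out of an elliptic curve over `ℚ` with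
`j = -140625/8`: model `[1, -1, 1, -5, 5]` (`Δ = -648`), witness `ℓ = 7`, `#Ẽ(𝔽_7) = 6`,
`a_7 = 2`, and `X² - (2)X + 7` has no root modulo `9` (`noroot_E21_jm140625d8_7_9`).
[cite: Mazur1978, §6 Prop. 6.3 (1) (p. 153)] [cite: Kenku1982, proof of Thm. 1, pp. 200–201] -/
theorem noCyclic9_jm140625d8 {W W' : WeierstrassCurve ℚ} [W.IsElliptic] [W'.IsElliptic]
    (ψ : Isogeny W W') (hψ : ψ.IsCyclic) (hq : ψ.degree = 9) : W.j ≠ -140625 / 8 := by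
  have hj : (((⟨1, -1, 1, -5, 5⟩ : WeierstrassCurve ℤ)).c₄ : ℚ) ^ 3 /
      (((⟨1, -1, 1, -5, 5⟩ : WeierstrassCurve ℤ)).Δ : ℚ) = -140625 / 8 := by
    norm_num [WeierstrassCurve.Δ, WeierstrassCurve.c₄, WeierstrassCurve.b₂, WeierstrassCurve.b₄,
      WeierstrassCurve.b₆, WeierstrassCurve.b₈]
  have hnr : ∀ t : ZMod 9, t ^ 2 - ((2 : ℤ) : ZMod 9) * t + ((7 : ℕ) : ZMod 9) ≠ 0 := by
    simpa using noroot_E21_jm140625d8_7_9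
  rw [← hj]
  haveI : Fact (Nat.Prime 7) := ⟨by norm_num⟩
  haveI : Fact (Nat.Prime 3) := ⟨by norm_num⟩
  exact j_ne_of_primePow_row _ (B := 2) (by decide +kernel) (by decide +kernel) (by decide +kernel)
    (by decide +kernel) (ℓ := 7) (by decide +kernel) card_E21_jm140625d8_7 (p := 3)
    (k := 2) (by norm_num) (by norm_num) (by norm_num) hnr ψ hψ hq

/-- No cyclic `ℚ`-isogeny of degree `9 = 3²` out of an elliptic curve over `ℚ` with
`j = 3375/2`: model `[1, -1, 0, 3, -1]` (`Δ = -1458`), witness `ℓ = 7`, `#Ẽ(𝔽_7) = 6`,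
`a_7 = 2`, and `X² - (2)X + 7` has no root modulo `9` (`noroot_E21_j3375d2_7_9`).
[cite: Mazur1978, §6 Prop. 6.3 (1) (p. 153)] [cite: Kenku1982, proof of Thm. 1, pp. 200–201] -/
theorem noCyclic9_j3375d2 {W W' : WeierstrassCurve ℚ} [W.IsElliptic] [W'.IsElliptic]
    (ψ : Isogeny W W') (hψ : ψ.IsCyclic) (hq : ψ.degree = 9) : W.j ≠ 3375 / 2 := by
  have hj : (((⟨1, -1, 0, 3, -1⟩ : WeierstrassCurve ℤ)).c₄ : ℚ) ^ 3 /
      (((⟨1, -1, 0, 3, -1⟩ : WeierstrassCurve ℤ)).Δ : ℚ) = 3375 / 2 := by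
    norm_num [WeierstrassCurve.Δ, WeierstrassCurve.c₄, WeierstrassCurve.b₂, WeierstrassCurve.b₄,
      WeierstrassCurve.b₆, WeierstrassCurve.b₈]
  have hnr : ∀ t : ZMod 9, t ^ 2 - ((2 : ℤ) : ZMod 9) * t + ((7 : ℕ) : ZMod 9) ≠ 0 := by
    simpa using noroot_E21_j3375d2_7_9
  rw [← hj]
  haveI : Fact (Nat.Prime 7) := ⟨by norm_num⟩
  haveI : Fact (Nat.Prime 3) := ⟨by norm_num⟩
  exact j_ne_of_primePow_row _ (B := 2) (by decide +kernel) (by decide +kernel) (by decide +kernel)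
    (by decide +kernel) (ℓ := 7) (by decide +kernel) card_E21_j3375d2_7 (p := 3)
    (k := 2) (by norm_num) (by norm_num) (by norm_num) hnr ψ hψ hq

/-- No cyclic `ℚ`-isogeny of degree `9 = 3²` out of an elliptic curve over `ℚ` with
`j = -1159088625/2097152`: model `[1, -1, 1, -95, -697]` (`Δ = -169869312`), witness `ℓ = 7`, `#Ẽ(𝔽_7) = 6`,
`a_7 = 2`, and `X² - (2)X + 7` has no root modulo `9` (`noroot_E21_jm1159088625d2097152_7_9`).
[cite: Mazur1978, §6 Prop. 6.3 (1) (p. 153)] [cite: Kenku1982, proof of Thm. 1, pp. 200–201] -/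
theorem noCyclic9_jm1159088625d2097152 {W W' : WeierstrassCurve ℚ} [W.IsElliptic] [W'.IsElliptic]
    (ψ : Isogeny W W') (hψ : ψ.IsCyclic) (hq : ψ.degree = 9) : W.j ≠ -1159088625 / 2097152 := by
  have hj : (((⟨1, -1, 1, -95, -697⟩ : WeierstrassCurve ℤ)).c₄ : ℚ) ^ 3 /
      (((⟨1, -1, 1, -95, -697⟩ : WeierstrassCurve ℤ)).Δ : ℚ) = -1159088625 / 2097152 := by
    norm_num [WeierstrassCurve.Δ, WeierstrassCurve.c₄, WeierstrassCurve.b₂, WeierstrassCurve.b₄,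
      WeierstrassCurve.b₆, WeierstrassCurve.b₈]
  have hnr : ∀ t : ZMod 9, t ^ 2 - ((2 : ℤ) : ZMod 9) * t + ((7 : ℕ) : ZMod 9) ≠ 0 := by
    simpa using noroot_E21_jm1159088625d2097152_7_9
  rw [← hj]
  haveI : Fact (Nat.Prime 7) := ⟨by norm_num⟩
  haveI : Fact (Nat.Prime 3) := ⟨by norm_num⟩
  exact j_ne_of_primePow_row _ (B := 5) (by decide +kernel) (by decide +kernel) (by decide +kernel)
    (by decide +kernel) (ℓ := 7) (by decide +kernel) card_E21_jm1159088625d2097152_7 (p := 3)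
    (k := 2) (by norm_num) (by norm_num) (by norm_num) hnr ψ hψ hq

/-- No cyclic `ℚ`-isogeny of degree `9 = 3²` out of an elliptic curve over `ℚ` with
`j = -189613868625/128`: model `[1, -1, 0, -1077, 13877]` (`Δ = -93312`), witness `ℓ = 7`, `#Ẽ(𝔽_7) = 6`,
`a_7 = 2`, and `X² - (2)X + 7` has no root modulo `9` (`noroot_E21_jm189613868625d128_7_9`).
[cite: Mazur1978, §6 Prop. 6.3 (1) (p. 153)] [cite: Kenku1982, proof of Thm. 1, pp. 200–201] -/
theorem noCyclic9_jm189613868625d128 {W W' : WeierstrassCurve ℚ} [W.IsElliptic] [W'.IsElliptic]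
    (ψ : Isogeny W W') (hψ : ψ.IsCyclic) (hq : ψ.degree = 9) : W.j ≠ -189613868625 / 128 := by
  have hj : (((⟨1, -1, 0, -1077, 13877⟩ : WeierstrassCurve ℤ)).c₄ : ℚ) ^ 3 /
      (((⟨1, -1, 0, -1077, 13877⟩ : WeierstrassCurve ℤ)).Δ : ℚ) = -189613868625 / 128 := by
    norm_num [WeierstrassCurve.Δ, WeierstrassCurve.c₄, WeierstrassCurve.b₂, WeierstrassCurve.b₄,
      WeierstrassCurve.b₆, WeierstrassCurve.b₈]
  have hnr : ∀ t : ZMod 9, t ^ 2 - ((2 : ℤ) : ZMod 9) * t + ((7 : ℕ) : ZMod 9) ≠ 0 := by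
    simpa using noroot_E21_jm189613868625d128_7_9
  rw [← hj]
  haveI : Fact (Nat.Prime 7) := ⟨by norm_num⟩
  haveI : Fact (Nat.Prime 3) := ⟨by norm_num⟩
  exact j_ne_of_primePow_row _ (B := 3) (by decide +kernel) (by decide +kernel) (by decide +kernel)
    (by decide +kernel) (ℓ := 7) (by decide +kernel) card_E21_jm189613868625d128_7 (p := 3)
    (k := 2) (by norm_num) (by norm_num) (by norm_num) hnr ψ hψ hq

/-- No cyclic `ℚ`-isogeny of degree `25 = 5²` out of an elliptic curve over `ℚ` with
`j = -25/2`: model `[1, 0, 1, -1, -2]` (`Δ = -1250`), witness `ℓ = 11`, `#Ẽ(𝔽_11) = 15`,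
`a_11 = -3`, and `X² - (-3)X + 11` has no root modulo `25` (`noroot_E15_jm25d2_11_25`).
[cite: Mazur1978, §6 Prop. 6.3 (1) (p. 153)] [cite: Kenku1982, proof of Thm. 1, pp. 200–201] -/
theorem noCyclic25_jm25d2 {W W' : WeierstrassCurve ℚ} [W.IsElliptic] [W'.IsElliptic]
    (ψ : Isogeny W W') (hψ : ψ.IsCyclic) (hq : ψ.degree = 25) : W.j ≠ -25 / 2 := by
  have hj : (((⟨1, 0, 1, -1, -2⟩ : WeierstrassCurve ℤ)).c₄ : ℚ) ^ 3 /
      (((⟨1, 0, 1, -1, -2⟩ : WeierstrassCurve ℤ)).Δ : ℚ) = -25 / 2 := by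
    norm_num [WeierstrassCurve.Δ, WeierstrassCurve.c₄, WeierstrassCurve.b₂, WeierstrassCurve.b₄,
      WeierstrassCurve.b₆, WeierstrassCurve.b₈]
  have hnr : ∀ t : ZMod 25, t ^ 2 - ((-3 : ℤ) : ZMod 25) * t + ((11 : ℕ) : ZMod 25) ≠ 0 := by
    simpa using noroot_E15_jm25d2_11_25
  rw [← hj]
  haveI : Fact (Nat.Prime 11) := ⟨by norm_num⟩
  haveI : Fact (Nat.Prime 5) := ⟨by norm_num⟩
  exact j_ne_of_primePow_row _ (B := 2) (by decide +kernel) (by decide +kernel) (by decide +kernel)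
    (by decide +kernel) (ℓ := 11) (by decide +kernel) card_E15_jm25d2_11 (p := 5)
    (k := 2) (by norm_num) (by norm_num) (by norm_num) hnr ψ hψ hq

/-- No cyclic `ℚ`-isogeny of degree `25 = 5²` out of an elliptic curve over `ℚ` with
`j = -349938025/8`: model `[1, 0, 1, -126, -552]` (`Δ = -5000`), witness `ℓ = 11`, `#Ẽ(𝔽_11) = 15`,
`a_11 = -3`, and `X² - (-3)X + 11` has no root modulo `25` (`noroot_E15_jm349938025d8_11_25`).
[cite: Mazur1978, §6 Prop. 6.3 (1) (p. 153)] [cite: Kenku1982, proof of Thm. 1, pp. 200–201] -/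
theorem noCyclic25_jm349938025d8 {W W' : WeierstrassCurve ℚ} [W.IsElliptic] [W'.IsElliptic]
    (ψ : Isogeny W W') (hψ : ψ.IsCyclic) (hq : ψ.degree = 25) : W.j ≠ -349938025 / 8 := by
  have hj : (((⟨1, 0, 1, -126, -552⟩ : WeierstrassCurve ℤ)).c₄ : ℚ) ^ 3 /
      (((⟨1, 0, 1, -126, -552⟩ : WeierstrassCurve ℤ)).Δ : ℚ) = -349938025 / 8 := by
    norm_num [WeierstrassCurve.Δ, WeierstrassCurve.c₄, WeierstrassCurve.b₂, WeierstrassCurve.b₄,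
      WeierstrassCurve.b₆, WeierstrassCurve.b₈]
  have hnr : ∀ t : ZMod 25, t ^ 2 - ((-3 : ℤ) : ZMod 25) * t + ((11 : ℕ) : ZMod 25) ≠ 0 := by
    simpa using noroot_E15_jm349938025d8_11_25
  rw [← hj]
  haveI : Fact (Nat.Prime 11) := ⟨by norm_num⟩
  haveI : Fact (Nat.Prime 5) := ⟨by norm_num⟩
  exact j_ne_of_primePow_row _ (B := 3) (by decide +kernel) (by decide +kernel) (by decide +kernel)
    (by decide +kernel) (ℓ := 11) (by decide +kernel) card_E15_jm349938025d8_11 (p := 5)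
    (k := 2) (by norm_num) (by norm_num) (by norm_num) hnr ψ hψ hq

/-- No cyclic `ℚ`-isogeny of degree `25 = 5²` out of an elliptic curve over `ℚ` with
`j = -121945/32`: model `[1, 1, 1, -3, 1]` (`Δ = -800`), witness `ℓ = 11`, `#Ẽ(𝔽_11) = 15`,
`a_11 = -3`, and `X² - (-3)X + 11` has no root modulo `25` (`noroot_E15_jm121945d32_11_25`).
[cite: Mazur1978, §6 Prop. 6.3 (1) (p. 153)] [cite: Kenku1982, proof of Thm. 1, pp. 200–201] -/
theorem noCyclic25_jm121945d32 {W W' : WeierstrassCurve ℚ} [W.IsElliptic] [W'.IsElliptic]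
    (ψ : Isogeny W W') (hψ : ψ.IsCyclic) (hq : ψ.degree = 25) : W.j ≠ -121945 / 32 := by
  have hj : (((⟨1, 1, 1, -3, 1⟩ : WeierstrassCurve ℤ)).c₄ : ℚ) ^ 3 /
      (((⟨1, 1, 1, -3, 1⟩ : WeierstrassCurve ℤ)).Δ : ℚ) = -121945 / 32 := by
    norm_num [WeierstrassCurve.Δ, WeierstrassCurve.c₄, WeierstrassCurve.b₂, WeierstrassCurve.b₄,
      WeierstrassCurve.b₆, WeierstrassCurve.b₈]
  have hnr : ∀ t : ZMod 25, t ^ 2 - ((-3 : ℤ) : ZMod 25) * t + ((11 : ℕ) : ZMod 25) ≠ 0 := by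
    simpa using noroot_E15_jm121945d32_11_25
  rw [← hj]
  haveI : Fact (Nat.Prime 11) := ⟨by norm_num⟩
  haveI : Fact (Nat.Prime 5) := ⟨by norm_num⟩
  exact j_ne_of_primePow_row _ (B := 2) (by decide +kernel) (by decide +kernel) (by decide +kernel)
    (by decide +kernel) (ℓ := 11) (by decide +kernel) card_E15_jm121945d32_11 (p := 5)
    (k := 2) (by norm_num) (by norm_num) (by norm_num) hnr ψ hψ hq

/-- No cyclic `ℚ`-isogeny of degree `25 = 5²` out of an elliptic curve over `ℚ` with
`j = 46969655/32768`: model `[1, 1, 1, 22, -9]` (`Δ = -819200`), witness `ℓ = 11`, `#Ẽ(𝔽_11) = 15`,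
`a_11 = -3`, and `X² - (-3)X + 11` has no root modulo `25` (`noroot_E15_j46969655d32768_11_25`).
[cite: Mazur1978, §6 Prop. 6.3 (1) (p. 153)] [cite: Kenku1982, proof of Thm. 1, pp. 200–201] -/
theorem noCyclic25_j46969655d32768 {W W' : WeierstrassCurve ℚ} [W.IsElliptic] [W'.IsElliptic]
    (ψ : Isogeny W W') (hψ : ψ.IsCyclic) (hq : ψ.degree = 25) : W.j ≠ 46969655 / 32768 := by
  have hj : (((⟨1, 1, 1, 22, -9⟩ : WeierstrassCurve ℤ)).c₄ : ℚ) ^ 3 /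
      (((⟨1, 1, 1, 22, -9⟩ : WeierstrassCurve ℤ)).Δ : ℚ) = 46969655 / 32768 := by
    norm_num [WeierstrassCurve.Δ, WeierstrassCurve.c₄, WeierstrassCurve.b₂, WeierstrassCurve.b₄,
      WeierstrassCurve.b₆, WeierstrassCurve.b₈]
  have hnr : ∀ t : ZMod 25, t ^ 2 - ((-3 : ℤ) : ZMod 25) * t + ((11 : ℕ) : ZMod 25) ≠ 0 := by
    simpa using noroot_E15_j46969655d32768_11_25
  rw [← hj]
  haveI : Fact (Nat.Prime 11) := ⟨by norm_num⟩
  haveI : Fact (Nat.Prime 5) := ⟨by norm_num⟩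
  exact j_ne_of_primePow_row _ (B := 4) (by decide +kernel) (by decide +kernel) (by decide +kernel)
    (by decide +kernel) (ℓ := 11) (by decide +kernel) card_E15_j46969655d32768_11 (p := 5)
    (k := 2) (by norm_num) (by norm_num) (by norm_num) hnr ψ hψ hq

end Literature.NumberTheory.EllipticCurves.KenkuLevelsCert

end
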